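import Mathlib
import Summits.ValiantsHypothesis.ValiantsHypothesis.Theorems.DivisionGapTriangularDimersDivisionEasyOddJoinDefs

/-!
# Crux `DivisionGap.TriangularDimersDivisionEasy` (stmt-ValiantsHypothesis-5067), line `Sketch` —
registered stub `stub_swapIdentity`

For even `n`, the FREE renaming `swapVar n` (exchange `x_e ↔ x_(e.swap)` on the edges `e` of the
reference perfect matching `pm0 n` of the rhombus `R_n`, identity elsewhere) carries the
even-subgraph polynomial
`evenSplit n = Σ_{H ∈ evenSubgraphs n} Π_{e ∈ H} x_e · Π_{e ∈ edges n \ H} x_(e.swap)`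
to the odd-join polynomial
`oddJoinSplit n = Σ_{J ∈ oddCovers n} Π_{e ∈ J} x_e · Π_{e ∈ edges n \ J} x_(e.swap)`.

## Proof

* `pm0 n ⊆ edges n`, members of `edges n` are forward pairs and the reversal of a forward pair is
  not forward; hence for an edge `e`: `swapVar n e = e.swap`, `swapVar n e.swap = e` if
  `e ∈ pm0 n`, and `swapVar n e = e`, `swapVar n e.swap = e.swap` otherwise.
* `rename` is a ring map, so `rename σ (evenSplit n) = Σ_H Π_{e ∈ H} x_(σ e) · Π_{e ∉ H} x_(σ e.swap)`.
  Writing each summand as ONE product over `edges n` and comparing factors (four membership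
  cases in `H` and `pm0 n`) shows that the summand of `H` is the split monomial of `H ∆ pm0 n`.
* `H ↦ H ∆ pm0 n` is an involution of the subsets of `edges n` that exchanges `evenSubgraphs n`
  and `oddCovers n`: filtering by incidence to a vertex commutes with `∆`,
  `#(A ∆ B) + 2 #(A ∩ B) = #A + #B` flips no parity, and every vertex `(i, j)` has degree
  exactly `1` in `pm0 n` when `n` is even (it lies only on the column pair
  `(i, 2⌊j/2⌋)–(i, 2⌊j/2⌋ + 1)`, which exists because `n` is even) — the only place where the
  parity of `n` is used.  `Finset.sum_nbij'` concludes.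
-/

-- `Summit.ValiantsHypothesis.ValiantsHypothesis.…` is the tree's mandated single-conjunct layout (Sub = Summit).
set_option linter.dupNamespace false

namespace Summit.ValiantsHypothesis.ValiantsHypothesis.Theorems.TriangularDimersDivisionEasy.OddJoin

open scoped BigOperators NNReal symmDiff
open Finset MvPolynomial

noncomputable section

namespace SwapIdentity
/-! ### Helper lemmas for `stub_swapIdentity` (this file's private namespace) -/

variable {n : ℕ}

/-! #### Edges, the reference matching `pm0 n` and the swap `swapVar n` -/

/-- Members of `edges n` are forward pairs. [folklore] -/
theorem isFwd_of_mem_edges {e : Var n} (he : e ∈ edges n) : IsFwd e := by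
  unfold edges at he
  exact (mem_filter.mp he).2

/-- The reversal of a forward pair is not forward. [folklore] -/
theorem not_isFwd_swap {e : Var n} (h : IsFwd e) : ¬ IsFwd e.swap := by
  intro h'
  simp only [IsFwd, Prod.fst_swap, Prod.snd_swap] at h h'
  omega

/-- `pm0 n ⊆ edges n`. [folklore] -/
theorem pm0_subset_edges : pm0 n ⊆ edges n := by
  unfold pm0
  exact filter_subset _ _

/-- The reversal of an edge is not in `pm0 n`. [folklore] -/
theorem swap_not_mem_pm0 {e : Var n} (he : e ∈ edges n) : e.swap ∉ pm0 n := fun h =>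
  not_isFwd_swap (isFwd_of_mem_edges he) (isFwd_of_mem_edges (pm0_subset_edges h))

/-- The permutation `swapVar n` is the function `swapFun n`. [folklore] -/
theorem coe_swapVar : (swapVar n : Var n → Var n) = swapFun n := rfl

/-- The swap on an edge `e`: `e.swap` if `e ∈ pm0 n`, else `e`. [folklore] -/
theorem swapVar_apply {e : Var n} (he : e ∈ edges n) :
    swapVar n e = if e ∈ pm0 n then e.swap else e := by
  rw [coe_swapVar]
  unfold swapFun
  by_cases h : e ∈ pm0 n
  · rw [if_pos (Or.inl h), if_pos h]
  · rw [if_neg (not_or.mpr ⟨h, swap_not_mem_pm0 he⟩), if_neg h]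

/-- The swap on the reversal of an edge `e`: `e` if `e ∈ pm0 n`, else `e.swap`. [folklore] -/
theorem swapVar_apply_swap {e : Var n} (he : e ∈ edges n) :
    swapVar n e.swap = if e ∈ pm0 n then e else e.swap := by
  rw [coe_swapVar]
  unfold swapFun
  rw [Prod.swap_swap]
  by_cases h : e ∈ pm0 n
  · rw [if_pos (Or.inr h), if_pos h]
  · rw [if_neg (not_or.mpr ⟨swap_not_mem_pm0 he, h⟩), if_neg h]

/-! #### The summand of `H` after the swap is the split monomial of `H ∆ pm0 n` -/

/-- A split product `Π_{e ∈ H} a e · Π_{e ∈ E ∖ H} b e` as one product over `E = edges n`.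
[folklore] -/
theorem prod_mul_prod_sdiff {H : Finset (Var n)} (hH : H ⊆ edges n)
    (a b : Var n → MvPolynomial (Var n) ℝ≥0) :
    (∏ e ∈ H, a e) * ∏ e ∈ edges n \ H, b e = ∏ e ∈ edges n, if e ∈ H then a e else b e := by
  rw [prod_ite, filter_mem_eq_inter, inter_eq_right.mpr hH, filter_notMem_eq_sdiff]

/-- `H ∆ pm0 n ⊆ edges n` for `H ⊆ edges n`. [folklore] -/
theorem symmDiff_pm0_subset {H : Finset (Var n)} (hH : H ⊆ edges n) : H ∆ pm0 n ⊆ edges n :=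
  symmDiff_subset_union.trans (union_subset hH pm0_subset_edges)

/-- The swapped split monomial of `H ⊆ edges n` is the split monomial of `H ∆ pm0 n`. [folklore] -/
theorem summand_eq {H : Finset (Var n)} (hH : H ⊆ edges n) :
    (∏ e ∈ H, (X (swapVar n e) : MvPolynomial (Var n) ℝ≥0)) *
        ∏ e ∈ edges n \ H, X (swapVar n e.swap) =
      (∏ e ∈ H ∆ pm0 n, X e) * ∏ e ∈ edges n \ (H ∆ pm0 n), X e.swap := by
  rw [prod_mul_prod_sdiff hH, prod_mul_prod_sdiff (symmDiff_pm0_subset hH)]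
  refine prod_congr rfl fun e he => ?_
  rw [swapVar_apply he, swapVar_apply_swap he]
  by_cases h1 : e ∈ H <;> by_cases h2 : e ∈ pm0 n <;> simp [h1, h2, mem_symmDiff]

/-! #### `H ↦ H ∆ pm0 n` exchanges even subgraphs and odd covers (`n` even) -/

/-- Filtering commutes with symmetric difference. [folklore] -/
theorem filter_symmDiff (p : Var n → Prop) [DecidablePred p] (A B : Finset (Var n)) :
    (A ∆ B).filter p = A.filter p ∆ B.filter p := by
  ext x
  simp only [mem_filter, mem_symmDiff]
  tauto

-- adapted from `Literature.Probability.LatticeModels.MeanFieldDifferentialInequality`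
-- (`card_symmDiff_add_two_mul`), re-proved here to keep the imports light.
/-- `#(A ∆ B) + 2 #(A ∩ B) = #A + #B`. [folklore] -/
theorem card_symmDiff_add_two_mul_card_inter (A B : Finset (Var n)) :
    (A ∆ B).card + 2 * (A ∩ B).card = A.card + B.card := by
  rw [Finset.symmDiff_def, card_union_of_disjoint disjoint_sdiff_sdiff]
  have h1 := card_sdiff_add_card_inter A B
  have h2 := card_sdiff_add_card_inter B A
  rw [inter_comm B A] at h2
  omega

/-- Parity of a degree in a symmetric difference. [folklore] -/
theorem even_deg_symmDiff_iff (A B : Finset (Var n)) (v : Vtx n) :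
    Even (deg (A ∆ B) v) ↔ (Even (deg A v) ↔ Even (deg B v)) := by
  unfold deg
  rw [filter_symmDiff]
  have h := card_symmDiff_add_two_mul_card_inter (A.filter fun e => e.1 = v ∨ e.2 = v)
    (B.filter fun e => e.1 = v ∨ e.2 = v)
  simp only [Nat.even_iff]
  omega

/-- Unfolded membership in `pm0 n` (the forwardness conjunct is implied by the column-pair
condition). [folklore] -/
theorem mem_pm0_iff (e : Var n) :
    e ∈ pm0 n ↔ (e.1.1 : ℕ) = e.2.1 ∧ (e.1.2 : ℕ) + 1 = e.2.2 ∧ Even (e.1.2 : ℕ) := by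
  unfold pm0 edges
  simp only [mem_filter, mem_univ, true_and]
  constructor
  · exact fun h => h.2
  · exact fun h => ⟨Or.inr (Or.inl ⟨h.1, h.2.1⟩), h⟩

/-- For even `n`, every vertex has degree exactly `1` in `pm0 n` (THE use of the parity of `n`:
the column pair through `(i, j)` with `j` even needs `j + 1 < n`). [folklore] -/
theorem deg_pm0 (hn : Even n) (v : Vtx n) : deg (pm0 n) v = 1 := by
  have hn2 : n % 2 = 0 := Nat.even_iff.mp hn
  obtain ⟨i, j⟩ := v
  have hjn : (j : ℕ) < n := j.isLt
  unfold deg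
  rw [card_eq_one]
  rcases Nat.even_or_odd (j : ℕ) with hj | hj
  · have hj2 : (j : ℕ) % 2 = 0 := Nat.even_iff.mp hj
    have hlt : (j : ℕ) + 1 < n := by omega
    refine ⟨((i, j), (i, ⟨(j : ℕ) + 1, hlt⟩)), ?_⟩
    ext ⟨⟨a, b⟩, ⟨c, d⟩⟩
    simp only [mem_filter, mem_singleton, mem_pm0_iff, Prod.mk.injEq, Fin.ext_iff, Nat.even_iff]
    omega
  · have hj2 : (j : ℕ) % 2 = 1 := Nat.odd_iff.mp hj
    refine ⟨((i, ⟨(j : ℕ) - 1, by omega⟩), (i, j)), ?_⟩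
    ext ⟨⟨a, b⟩, ⟨c, d⟩⟩
    simp only [mem_filter, mem_singleton, mem_pm0_iff, Prod.mk.injEq, Fin.ext_iff, Nat.even_iff]
    omega

/-- Unfolded membership in `evenSubgraphs n`. [folklore] -/
theorem mem_evenSubgraphs_iff (H : Finset (Var n)) :
    H ∈ evenSubgraphs n ↔ H ⊆ edges n ∧ ∀ v, Even (deg H v) := by
  unfold evenSubgraphs
  rw [mem_filter, mem_powerset]

/-- Unfolded membership in `oddCovers n`. [folklore] -/
theorem mem_oddCovers_iff (J : Finset (Var n)) :
    J ∈ oddCovers n ↔ J ⊆ edges n ∧ ∀ v, Odd (deg J v) := by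
  unfold oddCovers
  rw [mem_filter, mem_powerset]

/-- For even `n`, `H ↦ H ∆ pm0 n` maps even subgraphs to odd covers. [folklore] -/
theorem symmDiff_mem_oddCovers (hn : Even n) {H : Finset (Var n)} (hH : H ∈ evenSubgraphs n) :
    H ∆ pm0 n ∈ oddCovers n := by
  rw [mem_evenSubgraphs_iff] at hH
  rw [mem_oddCovers_iff]
  refine ⟨symmDiff_pm0_subset hH.1, fun v => ?_⟩
  rw [← Nat.not_even_iff_odd, even_deg_symmDiff_iff, deg_pm0 hn v]
  exact fun h => Nat.not_even_one (h.mp (hH.2 v))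

/-- For even `n`, `J ↦ J ∆ pm0 n` maps odd covers to even subgraphs. [folklore] -/
theorem symmDiff_mem_evenSubgraphs (hn : Even n) {J : Finset (Var n)} (hJ : J ∈ oddCovers n) :
    J ∆ pm0 n ∈ evenSubgraphs n := by
  rw [mem_oddCovers_iff] at hJ
  rw [mem_evenSubgraphs_iff]
  refine ⟨symmDiff_pm0_subset hJ.1, fun v => ?_⟩
  rw [even_deg_symmDiff_iff, deg_pm0 hn v]
  exact ⟨fun h => absurd h (Nat.not_even_iff_odd.mpr (hJ.2 v)), fun h => absurd h Nat.not_even_one⟩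

end SwapIdentity

open SwapIdentity in
/-- Registered stub `stub_swapIdentity`: for even `n`, the free renaming `swapVar n` (exchange
`x_e ↔ x_(e.swap)` on the edges of the reference perfect matching `pm0 n`) carries the even-subgraph
polynomial `evenSplit n` to the odd-join polynomial `oddJoinSplit n` (both in split variables).
[folklore] -/
theorem stub_swapIdentity (n : ℕ) (hn : Even n) : rename (swapVar n) (evenSplit n) = oddJoinSplit n := by
  simp only [evenSplit, oddJoinSplit, map_sum, map_mul, map_prod, rename_X]
  exact sum_nbij' (fun H => H ∆ pm0 n) (fun J => J ∆ pm0 n)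
    (fun H hH => symmDiff_mem_oddCovers hn hH) (fun J hJ => symmDiff_mem_evenSubgraphs hn hJ)
    (fun H _ => symmDiff_symmDiff_cancel_right _ _) (fun J _ => symmDiff_symmDiff_cancel_right _ _)
    fun H hH => summand_eq ((mem_evenSubgraphs_iff H).mp hH).1

end

end Summit.ValiantsHypothesis.ValiantsHypothesis.Theorems.TriangularDimersDivisionEasy.OddJoin
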